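import Literature.AlgebraicGeometry.Milne1999.MumfordTateEqLefschetzGroupPowersProducts
import Literature.AlgebraicGeometry.Milne1999.SpecialLefschetzGroupOneIsogenyFactors
import HarnessLib

/-!
# The general Weil-type abelian variety: `Hg ⊊ L` and `Hg′ ⊊ S` on every power, on everything isogenous to a power, and on
# every product with it (Milne 1999 Prop. 4.8 / Remark 4.9; Milne, Example 1.17; van Geemen 1994 Thm. 6.12, 3.6)

Milne [Milne2025AbelianMotivesCharP, §1.5 Example 1.17]: for a general polarized abelian variety of Weil type «the Weil classes
are Hodge classes but not Lefschetz classes», `SU(φ) = MT ⊊ L = GU(φ)`; [Milne1999LefschetzClasses, Prop. 4.8 and Remark 4.9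
(p. 660)]: `Hg(A) = L(A)` iff no power of `A` supports an exotic Hodge class, which fails for the general Weil-type variety;
[vanGeemen1994HodgeAV, 3.6 (p. 236)]: the space of Hodge classes, and `B = D`, are isogeny invariants.

The tree has, for the general CM-Weil member (`Deligne1982/WeilTypeCMGeneralMemberLefschetzGroup`:
`IsWeilTypeCM.mumfordTateGroup_lt_lefschetzGroup_of_hodgeGroupSU`, `….hodgeGroup_powSucc_ne_specialLefschetzGroup_of_hodgeGroupSU`,
`mumfordTateGroup_ne_lefschetzGroup_of_isIsogenous_of_hasHodgeGroupSUCM`) and for van Geemen's quadratic general member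
(`VanGeemen1994.mumfordTateGroup_lt_lefschetzGroup_of_hasHodgeGroupSU`, `…_powSucc_…`, `…_of_isIsogenous_…`) the statements on
`A`, on `A^{N+1}` (for `Hg′ ≠ S`) and on the isogeny class of `A`. With `Milne1999/MumfordTateEqLefschetzGroupPowersProducts`
(Prop. 4.8 (b)/(c) under powers, products, isogeny to a power) this file (all `theorem`s, no definition, no named fact) adds:
* §1 (CM-Weil general member, `k ≥ 2`) **`Hg(A^{N+1}) ⊊ L(A^{N+1})`, `Hg′(A^{N+1}) ⊊ S(A^{N+1})`; `Hg(C) ⊊ L(C)`, `Hg′(C) ≠ S(C)` and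
  `C` not stably nondegenerate for every `C ∼ A^{N+1}`; `Hg(A × B) ⊊ L(A × B)`, `Hg(B × A) ⊊ L(B × A)` for every `B`;
  `MT(C)|_{H¹} ⊊ L(C)|_{H¹}` for `C ∼ A^{N+1}`**;
* §2 the same for van Geemen's quadratic general member (`Hg = SU_H`, `n ≥ 2`).

## References

* [Milne1999LefschetzClasses] J. S. Milne, *Lefschetz classes on abelian varieties*, Duke Math. J. 96 (1999), Prop. 4.8, Remark 4.9
  (p. 660), Cor. 4.7.
* [Milne2025AbelianMotivesCharP] J. S. Milne, §1.5 Example 1.17 (general Weil type: `MT = SU(φ) ⊊ L = GU(φ)`).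
* [vanGeemen1994HodgeAV] B. van Geemen, *An introduction to the Hodge conjecture for abelian varieties* (1994), 3.6 (p. 236),
  Thm. 6.12.
-/

noncomputable section

open CategoryTheory Polynomial
open Literature.AlgebraicTopology.SingularHomology
open Literature.AlgebraicGeometry.Motives
open Literature.AlgebraicGeometry.HodgeTheory
open Literature.AlgebraicGeometry.VanGeemen1994
open Literature.AlgebraicGeometry.Milne1999

/-! ### §1 The general CM-Weil member -/

namespace Literature.AlgebraicGeometry.Deligne1982

variable {A : AbelianVariety ℂ} {η : A ⟶ A} {R : Polynomial ℤ} {e₀ k : ℕ} {h : complexBetti A.X 2}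

section CM

variable (hW : IsWeilTypeCM A η R e₀ k) (hpol : IsPolarizationClass A.dim A.X h) (hRos : IsRosatiCM A η h)

include hW hpol hRos in
/-- **`Hg(A^{N+1}) ⊊ L(A^{N+1})` on every power of the general CM-Weil member** (`k ≥ 2`): Prop. 4.8 (b) fails for `A`
(`IsWeilTypeCM.mumfordTateGroup_lt_lefschetzGroup_of_hodgeGroupSU`) and is insensitive to powers
(`AbelianVariety.mumfordTateGroup_powSucc_lt_lefschetzGroup_iff`). [cite: Milne1999LefschetzClasses, Prop. 4.8, Remark 4.9 (p. 660) and Cor. 4.7]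
[cite: Milne2025AbelianMotivesCharP, §1.5 Example 1.17] -/
theorem IsWeilTypeCM.mumfordTateGroup_powSucc_lt_lefschetzGroup_of_hodgeGroupSU (hk : 2 ≤ k)
    (hSU : HasHodgeGroupSUCM A η (R.comp (X ^ 2)) h) (N : ℕ) :
    mumfordTateGroup (A.powSucc N).dim (A.powSucc N).X < lefschetzGroup (A.powSucc N).dim (A.powSucc N).X := by
  have hdim : 1 ≤ A.dim := by have := hW.two_le_dim; omega
  exact (AbelianVariety.mumfordTateGroup_powSucc_lt_lefschetzGroup_iff (A := A) hdim N).2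
    (hW.mumfordTateGroup_lt_lefschetzGroup_of_hodgeGroupSU hpol hRos hk hSU)

include hW hpol hRos in
/-- **`Hg′(A^{N+1}) ⊊ S(A^{N+1})` on every power of the general CM-Weil member** (`k ≥ 2`; `Hg′ ≤ S` always).
[cite: Milne1999LefschetzClasses, Prop. 4.8, Remark 4.9 (p. 660) and Cor. 4.7] [cite: Milne2025AbelianMotivesCharP, §1.5 Example 1.17] -/
theorem IsWeilTypeCM.hodgeGroup_powSucc_lt_specialLefschetzGroup_of_hodgeGroupSU (hk : 2 ≤ k)
    (hSU : HasHodgeGroupSUCM A η (R.comp (X ^ 2)) h) (N : ℕ) :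
    hodgeGroup (A.powSucc N).dim (A.powSucc N).X < specialLefschetzGroup (A.powSucc N).dim (A.powSucc N).X :=
  lt_of_le_of_ne (A.powSucc N).hodgeGroup_le_specialLefschetzGroup.1
    (hW.hodgeGroup_powSucc_ne_specialLefschetzGroup_of_hodgeGroupSU hpol hRos hk hSU N)

include hW hpol hRos in
/-- **`Hg′(C) ≠ S(C)` for every `C` isogenous to a power `A^{N+1}` of the general CM-Weil member** (`k ≥ 2`).
[cite: Milne1999LefschetzClasses, Prop. 4.8 and Remark 4.9 (p. 660)] [cite: vanGeemen1994HodgeAV, 3.6 (p. 236)] -/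
theorem IsWeilTypeCM.hodgeGroup_ne_specialLefschetzGroup_of_isIsogenous_powSucc_of_hodgeGroupSU {C : AbelianVariety ℂ}
    (hk : 2 ≤ k) (hSU : HasHodgeGroupSUCM A η (R.comp (X ^ 2)) h) (N : ℕ)
    (hC : AbelianVariety.IsIsogenous C (A.powSucc N)) :
    hodgeGroup C.dim C.X ≠ specialLefschetzGroup C.dim C.X :=
  fun e ↦ hW.hodgeGroup_ne_specialLefschetzGroup_of_hodgeGroupSU hpol hRos hk hSU
    ((hodgeGroup_eq_specialLefschetzGroup_iff_of_isIsogenous_powSucc A N hC).1 e)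

include hW hpol hRos in
/-- **`Hg(C) ⊊ L(C)` for every `C` isogenous to a power `A^{N+1}` of the general CM-Weil member** (`k ≥ 2`).
[cite: Milne1999LefschetzClasses, Prop. 4.8 and Remark 4.9 (p. 660)] [cite: vanGeemen1994HodgeAV, 3.6 (p. 236)]
[cite: Milne2025AbelianMotivesCharP, §1.5 Example 1.17] -/
theorem IsWeilTypeCM.mumfordTateGroup_lt_lefschetzGroup_of_isIsogenous_powSucc_of_hodgeGroupSU {C : AbelianVariety ℂ}
    (hk : 2 ≤ k) (hSU : HasHodgeGroupSUCM A η (R.comp (X ^ 2)) h) (N : ℕ)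
    (hC : AbelianVariety.IsIsogenous C (A.powSucc N)) :
    mumfordTateGroup C.dim C.X < lefschetzGroup C.dim C.X := by
  have hdim : 1 ≤ A.dim := by have := hW.two_le_dim; omega
  refine lt_of_le_of_ne C.hodgeGroup_le_specialLefschetzGroup.2 fun e ↦ ?_
  exact (hW.mumfordTateGroup_lt_lefschetzGroup_of_hodgeGroupSU hpol hRos hk hSU).ne
    ((mumfordTateGroup_eq_lefschetzGroup_iff_of_isIsogenous_powSucc hdim N hC).1 e)

include hW hpol hRos in
/-- **No `C ∼ A^{N+1}` is stably nondegenerate** (`A` the general CM-Weil member, `k ≥ 2`): condition (D) would descend along the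
isogeny and from the power to `A`, which carries an exotic class. [cite: Milne1999LefschetzClasses, Prop. 4.8 and Remark 4.9 (p. 660)]
[cite: vanGeemen1994HodgeAV, 3.6 (p. 236) and Thm. 6.12] -/
theorem IsWeilTypeCM.not_isStablyNondegenerate_of_isIsogenous_powSucc_of_hodgeGroupSU {C : AbelianVariety ℂ}
    (hk : 2 ≤ k) (hSU : HasHodgeGroupSUCM A η (R.comp (X ^ 2)) h) (N : ℕ)
    (hC : AbelianVariety.IsIsogenous C (A.powSucc N)) : ¬ IsStablyNondegenerate C :=
  fun hs ↦ hW.not_isDivisorGenerated_powSucc_of_hodgeGroupSU hpol hRos hk hSU 0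
    (((isStablyNondegenerate_powSucc_iff A N).1 (hs.of_isIsogenous' hC)) 0)

include hW hpol hRos in
/-- **`Hg(A × B) ⊊ L(A × B)` for every complex abelian variety `B`** (`A` the general CM-Weil member, `k ≥ 2`): the exotic
classes of the powers of `A` pull back to the powers of `A × B`. [cite: Milne1999LefschetzClasses, Prop. 4.8 and Remark 4.9 (p. 660)]
[cite: vanGeemen1994HodgeAV, §2.5 (p. 235)] -/
theorem IsWeilTypeCM.mumfordTateGroup_prod_lt_lefschetzGroup_of_hodgeGroupSU (B : AbelianVariety ℂ) (hk : 2 ≤ k)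
    (hSU : HasHodgeGroupSUCM A η (R.comp (X ^ 2)) h) :
    mumfordTateGroup (A.prod B).dim (A.prod B).X < lefschetzGroup (A.prod B).dim (A.prod B).X := by
  have hdim : 1 ≤ A.dim := by have := hW.two_le_dim; omega
  exact AbelianVariety.mumfordTateGroup_prod_lt_lefschetzGroup_of_left B hdim
    (hW.mumfordTateGroup_lt_lefschetzGroup_of_hodgeGroupSU hpol hRos hk hSU)

include hW hpol hRos in
/-- **`Hg(B × A) ⊊ L(B × A)` for every complex abelian variety `B`** (`A` the general CM-Weil member, `k ≥ 2`).
[cite: Milne1999LefschetzClasses, Prop. 4.8 and Remark 4.9 (p. 660)] [cite: vanGeemen1994HodgeAV, §2.5 (p. 235)] -/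
theorem IsWeilTypeCM.mumfordTateGroup_prod_lt_lefschetzGroup_of_hodgeGroupSU' (B : AbelianVariety ℂ) (hk : 2 ≤ k)
    (hSU : HasHodgeGroupSUCM A η (R.comp (X ^ 2)) h) :
    mumfordTateGroup (B.prod A).dim (B.prod A).X < lefschetzGroup (B.prod A).dim (B.prod A).X := by
  have hdim : 1 ≤ A.dim := by have := hW.two_le_dim; omega
  refine lt_of_le_of_ne (B.prod A).hodgeGroup_le_specialLefschetzGroup.2 fun e ↦ ?_
  exact (hW.mumfordTateGroup_lt_lefschetzGroup_of_hodgeGroupSU hpol hRos hk hSU).ne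
    (AbelianVariety.mumfordTateGroup_eq_lefschetzGroup_right_of_prod B hdim e)

include hW hpol hRos in
/-- **`MT(C)(ℂ)|_{H¹} ⊊ L(C)(ℂ)|_{H¹}` for every `C ∼ A^{N+1}`** (`A` the general CM-Weil member, `k ≥ 2`): on `H¹`, «Mumford–Tate =
Lefschetz» is read off the isogeny type (`map_mumfordTateGroup_one_eq_map_lefschetzGroup_one_iff_of_isIsogenous_powSucc`) and
fails for `A` (`SU(φ) ⊊ GU(φ)`). [cite: Milne2025AbelianMotivesCharP, §1.5 Example 1.17] [cite: Milne1999LefschetzClasses, §4 pp. 659–660 and Cor. 4.7] -/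
theorem IsWeilTypeCM.map_mumfordTateGroup_one_lt_map_lefschetzGroup_one_of_isIsogenous_powSucc_of_hodgeGroupSU
    {C : AbelianVariety ℂ} (hk : 2 ≤ k) (hSU : HasHodgeGroupSUCM A η (R.comp (X ^ 2)) h) (N : ℕ)
    (hC : AbelianVariety.IsIsogenous C (A.powSucc N)) :
    (mumfordTateGroup C.dim C.X).map (Pi.evalMonoidHom (fun j : ℕ ↦ complexBetti C.X j ≃ₗ[ℂ] complexBetti C.X j) 1) <
      (lefschetzGroup C.dim C.X).map (Pi.evalMonoidHom (fun j : ℕ ↦ complexBetti C.X j ≃ₗ[ℂ] complexBetti C.X j) 1) := by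
  have hdim : 1 ≤ A.dim := by have := hW.two_le_dim; omega
  have hle : (mumfordTateGroup C.dim C.X).map (Pi.evalMonoidHom (fun j : ℕ ↦ complexBetti C.X j ≃ₗ[ℂ] complexBetti C.X j) 1) ≤
      (lefschetzGroup C.dim C.X).map (Pi.evalMonoidHom (fun j : ℕ ↦ complexBetti C.X j ≃ₗ[ℂ] complexBetti C.X j) 1) := by
    rw [← map_mumfordTateGroup_sup_map_specialLefschetzGroup_eq_map_lefschetzGroup (A := C)]
    exact le_sup_left
  refine lt_of_le_of_ne hle fun e ↦ ?_
  exact (hW.map_mumfordTateGroup_one_lt_map_lefschetzGroup_one_of_hodgeGroupSU' hpol hRos hk hSU).ne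
    ((map_mumfordTateGroup_one_eq_map_lefschetzGroup_one_iff_of_isIsogenous_powSucc A hdim N hC).1 e)

end CM

end Literature.AlgebraicGeometry.Deligne1982

/-! ### §2 Van Geemen's quadratic general member (`Hg = SU_H`) -/

namespace Literature.AlgebraicGeometry.VanGeemen1994

section Quadratic

variable (A : AbelianVariety ℂ) (φ : A ⟶ A) (n d : ℕ) (e : ProjectiveEmbedding A.X)
  (a : complexBetti (projectiveSpace e.n ℂ) 2) {C : AbelianVariety ℂ}

/-- **`Hg(A^{N+1}) ⊊ L(A^{N+1})` on every power of van Geemen's general member** (`n ≥ 2`).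
[cite: Milne1999LefschetzClasses, Prop. 4.8, Remark 4.9 (p. 660) and Cor. 4.7] [cite: vanGeemen1994HodgeAV, Thm. 6.12] -/
theorem mumfordTateGroup_powSucc_lt_lefschetzGroup_of_hasHodgeGroupSU (hn : 2 ≤ n) (hd : 0 < d) (hA : A.dim = 2 * n)
    (hφ : φ ≫ φ = -(d • 𝟙 A)) (ha : IsRationalClass a) (ha0 : a ≠ 0) (hSU : HasHodgeGroupSU A φ n d (hK d φ e a)) (N : ℕ) :
    mumfordTateGroup (A.powSucc N).dim (A.powSucc N).X < lefschetzGroup (A.powSucc N).dim (A.powSucc N).X :=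
  (AbelianVariety.mumfordTateGroup_powSucc_lt_lefschetzGroup_iff (A := A) (by omega) N).2
    (mumfordTateGroup_lt_lefschetzGroup_of_hasHodgeGroupSU A φ n d e a hn hd hA hφ ha ha0 hSU)

/-- **`Hg′(A^{N+1}) ⊊ S(A^{N+1})` on every power of van Geemen's general member** (`n ≥ 2`).
[cite: Milne1999LefschetzClasses, Prop. 4.8, Remark 4.9 (p. 660) and Cor. 4.7] [cite: vanGeemen1994HodgeAV, Thm. 6.12] -/
theorem hodgeGroup_powSucc_lt_specialLefschetzGroup_of_hasHodgeGroupSU (hn : 2 ≤ n) (hd : 0 < d) (hA : A.dim = 2 * n)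
    (hφ : φ ≫ φ = -(d • 𝟙 A)) (ha : IsRationalClass a) (ha0 : a ≠ 0) (hSU : HasHodgeGroupSU A φ n d (hK d φ e a)) (N : ℕ) :
    hodgeGroup (A.powSucc N).dim (A.powSucc N).X < specialLefschetzGroup (A.powSucc N).dim (A.powSucc N).X :=
  lt_of_le_of_ne (A.powSucc N).hodgeGroup_le_specialLefschetzGroup.1
    (hodgeGroup_powSucc_ne_specialLefschetzGroup_of_hasHodgeGroupSU A φ n d e a hn hd hA hφ ha ha0 hSU N)

/-- **`Hg′(C) ≠ S(C)` for every `C ∼ A^{N+1}`**, `A` van Geemen's general member (`n ≥ 2`).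
[cite: Milne1999LefschetzClasses, Prop. 4.8 and Remark 4.9 (p. 660)] [cite: vanGeemen1994HodgeAV, 3.6 (p. 236) and Thm. 6.12] -/
theorem hodgeGroup_ne_specialLefschetzGroup_of_isIsogenous_powSucc_of_hasHodgeGroupSU (hn : 2 ≤ n) (hd : 0 < d)
    (hA : A.dim = 2 * n) (hφ : φ ≫ φ = -(d • 𝟙 A)) (ha : IsRationalClass a) (ha0 : a ≠ 0)
    (hSU : HasHodgeGroupSU A φ n d (hK d φ e a)) (N : ℕ) (hC : AbelianVariety.IsIsogenous C (A.powSucc N)) :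
    hodgeGroup C.dim C.X ≠ specialLefschetzGroup C.dim C.X :=
  fun h ↦ hodgeGroup_ne_specialLefschetzGroup_of_hasHodgeGroupSU A φ n d e a hn hd hA hφ ha ha0 hSU
    ((hodgeGroup_eq_specialLefschetzGroup_iff_of_isIsogenous_powSucc A N hC).1 h)

/-- **`Hg(C) ⊊ L(C)` for every `C ∼ A^{N+1}`**, `A` van Geemen's general member (`n ≥ 2`).
[cite: Milne1999LefschetzClasses, Prop. 4.8 and Remark 4.9 (p. 660)] [cite: vanGeemen1994HodgeAV, 3.6 (p. 236) and Thm. 6.12] -/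
theorem mumfordTateGroup_lt_lefschetzGroup_of_isIsogenous_powSucc_of_hasHodgeGroupSU (hn : 2 ≤ n) (hd : 0 < d)
    (hA : A.dim = 2 * n) (hφ : φ ≫ φ = -(d • 𝟙 A)) (ha : IsRationalClass a) (ha0 : a ≠ 0)
    (hSU : HasHodgeGroupSU A φ n d (hK d φ e a)) (N : ℕ) (hC : AbelianVariety.IsIsogenous C (A.powSucc N)) :
    mumfordTateGroup C.dim C.X < lefschetzGroup C.dim C.X := by
  refine lt_of_le_of_ne C.hodgeGroup_le_specialLefschetzGroup.2 fun h ↦ ?_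
  exact (mumfordTateGroup_lt_lefschetzGroup_of_hasHodgeGroupSU A φ n d e a hn hd hA hφ ha ha0 hSU).ne
    ((mumfordTateGroup_eq_lefschetzGroup_iff_of_isIsogenous_powSucc (A := A) (by omega) N hC).1 h)

/-- **No `C ∼ A^{N+1}` is stably nondegenerate**, `A` van Geemen's general member (`n ≥ 2`).
[cite: Milne1999LefschetzClasses, Prop. 4.8 and Remark 4.9 (p. 660)] [cite: vanGeemen1994HodgeAV, 3.6 (p. 236) and Thm. 6.12] -/
theorem not_isStablyNondegenerate_of_isIsogenous_powSucc_of_hasHodgeGroupSU (hn : 2 ≤ n) (hd : 0 < d)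
    (hA : A.dim = 2 * n) (hφ : φ ≫ φ = -(d • 𝟙 A)) (ha : IsRationalClass a) (ha0 : a ≠ 0)
    (hSU : HasHodgeGroupSU A φ n d (hK d φ e a)) (N : ℕ) (hC : AbelianVariety.IsIsogenous C (A.powSucc N)) :
    ¬ IsStablyNondegenerate C :=
  fun hs ↦ not_isDivisorGenerated_powSucc_of_hasHodgeGroupSU A φ n d e a hn hd hA hφ ha ha0 hSU 0
    (((isStablyNondegenerate_powSucc_iff A N).1 (hs.of_isIsogenous' hC)) 0)

/-- **`Hg(A × B) ⊊ L(A × B)` for every `B`**, `A` van Geemen's general member (`n ≥ 2`).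
[cite: Milne1999LefschetzClasses, Prop. 4.8 and Remark 4.9 (p. 660)] [cite: vanGeemen1994HodgeAV, §2.5 (p. 235) and Thm. 6.12] -/
theorem mumfordTateGroup_prod_lt_lefschetzGroup_of_hasHodgeGroupSU (B : AbelianVariety ℂ) (hn : 2 ≤ n) (hd : 0 < d)
    (hA : A.dim = 2 * n) (hφ : φ ≫ φ = -(d • 𝟙 A)) (ha : IsRationalClass a) (ha0 : a ≠ 0)
    (hSU : HasHodgeGroupSU A φ n d (hK d φ e a)) :
    mumfordTateGroup (A.prod B).dim (A.prod B).X < lefschetzGroup (A.prod B).dim (A.prod B).X :=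
  AbelianVariety.mumfordTateGroup_prod_lt_lefschetzGroup_of_left B (by omega)
    (mumfordTateGroup_lt_lefschetzGroup_of_hasHodgeGroupSU A φ n d e a hn hd hA hφ ha ha0 hSU)

/-- **`Hg(B × A) ⊊ L(B × A)` for every `B`**, `A` van Geemen's general member (`n ≥ 2`).
[cite: Milne1999LefschetzClasses, Prop. 4.8 and Remark 4.9 (p. 660)] [cite: vanGeemen1994HodgeAV, §2.5 (p. 235) and Thm. 6.12] -/
theorem mumfordTateGroup_prod_lt_lefschetzGroup_of_hasHodgeGroupSU' (B : AbelianVariety ℂ) (hn : 2 ≤ n) (hd : 0 < d)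
    (hA : A.dim = 2 * n) (hφ : φ ≫ φ = -(d • 𝟙 A)) (ha : IsRationalClass a) (ha0 : a ≠ 0)
    (hSU : HasHodgeGroupSU A φ n d (hK d φ e a)) :
    mumfordTateGroup (B.prod A).dim (B.prod A).X < lefschetzGroup (B.prod A).dim (B.prod A).X := by
  refine lt_of_le_of_ne (B.prod A).hodgeGroup_le_specialLefschetzGroup.2 fun h ↦ ?_
  exact (mumfordTateGroup_lt_lefschetzGroup_of_hasHodgeGroupSU A φ n d e a hn hd hA hφ ha ha0 hSU).ne
    (AbelianVariety.mumfordTateGroup_eq_lefschetzGroup_right_of_prod B (by omega) h)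

end Quadratic

end Literature.AlgebraicGeometry.VanGeemen1994

end
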